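import Mathlib
import Summits.HodgeConjecture.HodgeConjecture.Theorems.HodgeLocusLVTermwiseLaw

/-!
# Hodge-locus census (cell `pub-hlocus`, ENGINE A, gen 46) — valuation parity of the interior terms in
the CM families `D = −3ℓ^(2k)` and `D = −4ℓ^(2k)` (Lemma V of ENGINE A's DERIVATION-VAL-A.md)

certified instances and evidence bearing on the general Hodge conjecture; no claim.

GENERAL, DEFINITION-FREE lemma sheet (no census data, no class polynomials).  Context: for the two
families of CM discriminants `D = −3ℓ^(2k)` (pair `d₁ = −3`, `d₂ = D`, `d₁d₂ = 9ℓ^(2k)`) and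
`D = −4ℓ^(2k)` (pair `d₁ = −4`, `d₁d₂ = 16ℓ^(2k)`), the Gross–Zagier / Lauter–Viray product formula whose `ℓ`-part
controls `v_ℓ(H_D(0))` resp. `v_ℓ(H_D(1728))` runs over the "interior" numerators `9ℓ^(2k) − x²` (`x` odd, `0 < x < 3ℓ^k`,
`ℓ` odd) resp. `4ℓ^(2k) − y²` (`0 < y < 2ℓ^k`) ([cite: GrossZagier1985SingularModuli, Thm. 1.3];
[cite: LauterViray2015SingularModuli, Thm. 1.1 and Thm. 1.5]).  ENGINE A's cell proposition A-VAL
(exact `ℓ`-adic valuations of `H_D(0)`, `H_D(1728)` on these families; registered and tested in the cell,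
NOT a cited fact) rests on an elementary LEMMA V: every interior numerator has EVEN `ℓ`-valuation — with no
exception for `9ℓ^(2k) − x²` at odd `ℓ`, and with the single exception `y = 3^k` (numerator `3^(2k+1)`)
for `4·3^(2k) − y²` at `ℓ = 3` (none at primes `ℓ ≠ 3`).  THIS FILE proves Lemma V as kernel theorems over `ℕ`
(valuations as `Nat.factorization`, as in the cell's other sheets).  The parity BELOW the top exponent is
the accepted `LVTermwiseLaw.factorization_even_or_ge` (Lemma 4 (I): `v_ℓ(m)` even or `≥ 2k`), imported and
used here with cofactor `a = 1`; what this file adds is the TOP EXCLUSION for the two families and the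
resulting unconditional parity:
* `pow_dvd_of_pow_dvd_sq` — `ℓ^(2s) ∣ x² ⇒ ℓ^s ∣ x`;
* `not_top_dvd_nine` — `ℓ` an odd prime, `x` odd, `x < 3ℓ^k` ⇒ `ℓ^(2k+1) ∤ 9ℓ^(2k) − x²`;
  `not_top_dvd_four` — `ℓ ≠ 3` prime, `0 < y < 2ℓ^k` ⇒ `ℓ^(2k+1) ∤ 4ℓ^(2k) − y²`;
  `eq_pow_of_top_dvd_four_three` — at `ℓ = 3` the only `y` with `3^(2k+1) ∣ 4·3^(2k) − y²` is `y = 3^k`,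
  and `four_pin_value` — there the numerator IS `3^(2k+1)`;
* `even_factorization_nine`, `even_factorization_four`, `even_factorization_four_three` — the parity
  statements of Lemma V.
NOT formalised: the step from Lemma V to the valuations of `H_D` (it uses the Hilbert-symbol law of
[cite: LauterViray2015SingularModuli, Thm. 1.1] and the counts of Thm. 1.5, hypothesis-level in the cell's
other sheets — Mathlib has no Hilbert symbol), and anything about class polynomials.  No internally-minted
statement is cited as a fact.  No `sorry`, no new axioms, no definitions.
-/

namespace Summit.HodgeConjecture.HodgeConjecture.HodgeLocus.Census.LVFamilyParity

set_option linter.dupNamespace false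

open Summit.HodgeConjecture.HodgeConjecture.HodgeLocus.Census.LVTermwiseLaw (factorization_even_or_ge)

/-! ## Square steps -/

/-- `ℓ^(2s) ∣ x² ⇒ ℓ^s ∣ x` for a prime `ℓ`. -/
theorem pow_dvd_of_pow_dvd_sq {ℓ : ℕ} (hℓ : ℓ.Prime) {x s : ℕ} (h : ℓ ^ (2 * s) ∣ x ^ 2) :
    ℓ ^ s ∣ x := by
  rcases Nat.eq_zero_or_pos x with rfl | hx
  · exact dvd_zero _
  have hx0 : x ≠ 0 := hx.ne'
  have hx2 : x ^ 2 ≠ 0 := pow_ne_zero 2 hx0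
  rw [hℓ.pow_dvd_iff_le_factorization hx2, Nat.factorization_pow] at h
  rw [hℓ.pow_dvd_iff_le_factorization hx0]
  simp only [Finsupp.smul_apply, smul_eq_mul] at h
  omega

/-! ## The top exponent: family `9ℓ^(2k) − x²` (`D = −3ℓ^(2k)`, `ℓ` odd, `x` odd) -/

/-- `(3ℓ^k)² = 9ℓ^(2k)`. -/
theorem sq_three_mul_pow (ℓ k : ℕ) : (3 * ℓ ^ k) ^ 2 = 9 * ℓ ^ (2 * k) := by
  rw [mul_pow, ← pow_mul, mul_comm k 2]; norm_num

/-- `(2ℓ^k)² = 4ℓ^(2k)`. -/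
theorem sq_two_mul_pow (ℓ k : ℕ) : (2 * ℓ ^ k) ^ 2 = 4 * ℓ ^ (2 * k) := by
  rw [mul_pow, ← pow_mul, mul_comm k 2]; norm_num

/-- TOP EXCLUSION (family `9ℓ^(2k) − x²`).  For an odd prime `ℓ` (the case `ℓ = 3` included) and odd
`x < 3ℓ^k`: `ℓ^(2k+1) ∤ 9ℓ^(2k) − x²`.  (Reason: else `ℓ^k ∣ x`, `x = ℓ^k·u` with `u` odd, `u < 3`, so
`u = 1` and the numerator is `8ℓ^(2k)`, forcing `ℓ ∣ 8`.) -/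
theorem not_top_dvd_nine {ℓ : ℕ} (hℓ : ℓ.Prime) (hℓ2 : ℓ ≠ 2) {k x : ℕ} (hx : Odd x)
    (hlt : x < 3 * ℓ ^ k) : ¬ ℓ ^ (2 * k + 1) ∣ 9 * ℓ ^ (2 * k) - x ^ 2 := by
  intro h
  have hℓpos : 0 < ℓ := hℓ.pos
  have hxlt2 : x ^ 2 < 9 * ℓ ^ (2 * k) := by
    rw [← sq_three_mul_pow]; exact Nat.pow_lt_pow_left hlt two_ne_zero
  have h2k : ℓ ^ (2 * k) ∣ 9 * ℓ ^ (2 * k) - x ^ 2 := (pow_dvd_pow ℓ (by omega)).trans h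
  have hx2 : ℓ ^ (2 * k) ∣ x ^ 2 := by
    have := Nat.dvd_sub (dvd_mul_left (ℓ ^ (2 * k)) 9) h2k
    rwa [Nat.sub_sub_self hxlt2.le] at this
  obtain ⟨u, hu⟩ : ℓ ^ k ∣ x := pow_dvd_of_pow_dvd_sq hℓ hx2
  have huodd : Odd u := by
    rw [hu] at hx; exact (Nat.odd_mul.mp hx).2
  have hu3 : u < 3 := by
    by_contra hcon
    have : ℓ ^ k * 3 ≤ ℓ ^ k * u := Nat.mul_le_mul_left _ (not_lt.mp hcon)
    rw [← hu] at this; omega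
  have hu1 : u = 1 := by obtain ⟨r, hr⟩ := huodd; omega
  subst hu1
  rw [mul_one] at hu
  subst hu
  have h8 : 9 * ℓ ^ (2 * k) - (ℓ ^ k) ^ 2 = ℓ ^ (2 * k) * 8 := by
    rw [← pow_mul, mul_comm k 2]; omega
  rw [h8, pow_succ] at h
  have h8' : ℓ ∣ 8 := Nat.dvd_of_mul_dvd_mul_left (pow_pos hℓpos _) h
  have h2 : ℓ ∣ 2 := hℓ.dvd_of_dvd_pow (show ℓ ∣ 2 ^ 3 by norm_num; exact h8')
  exact hℓ2 ((Nat.prime_dvd_prime_iff_eq hℓ Nat.prime_two).mp h2)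

/-! ## The top exponent: family `4ℓ^(2k) − y²` (`D = −4ℓ^(2k)`) -/

/-- Common step: `ℓ^(2k+1) ∣ 4ℓ^(2k) − y²` with `0 < y < 2ℓ^k` forces `y = ℓ^k` (any prime `ℓ`). -/
theorem eq_pow_of_top_dvd_four {ℓ : ℕ} (hℓ : ℓ.Prime) {k y : ℕ} (hy : 0 < y) (hlt : y < 2 * ℓ ^ k)
    (h : ℓ ^ (2 * k + 1) ∣ 4 * ℓ ^ (2 * k) - y ^ 2) : y = ℓ ^ k := by
  have hylt2 : y ^ 2 < 4 * ℓ ^ (2 * k) := by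
    rw [← sq_two_mul_pow]; exact Nat.pow_lt_pow_left hlt two_ne_zero
  have h2k : ℓ ^ (2 * k) ∣ 4 * ℓ ^ (2 * k) - y ^ 2 := (pow_dvd_pow ℓ (by omega)).trans h
  have hy2 : ℓ ^ (2 * k) ∣ y ^ 2 := by
    have := Nat.dvd_sub (dvd_mul_left (ℓ ^ (2 * k)) 4) h2k
    rwa [Nat.sub_sub_self hylt2.le] at this
  obtain ⟨u, hu⟩ : ℓ ^ k ∣ y := pow_dvd_of_pow_dvd_sq hℓ hy2
  have hu2 : u < 2 := by
    by_contra hcon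
    have : ℓ ^ k * 2 ≤ ℓ ^ k * u := Nat.mul_le_mul_left _ (not_lt.mp hcon)
    rw [← hu] at this; omega
  have hu0 : u ≠ 0 := by
    rintro rfl
    rw [mul_zero] at hu; omega
  have hu1 : u = 1 := by omega
  rw [hu1, mul_one] at hu
  exact hu

/-- At the pin `y = ℓ^k` the numerator is `3ℓ^(2k)`. -/
theorem four_sub_pin (ℓ k : ℕ) : 4 * ℓ ^ (2 * k) - (ℓ ^ k) ^ 2 = ℓ ^ (2 * k) * 3 := by
  rw [← pow_mul, mul_comm k 2]; omega

/-- TOP EXCLUSION (family `4ℓ^(2k) − y²`).  For a prime `ℓ ≠ 3` and `0 < y < 2ℓ^k`: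
`ℓ^(2k+1) ∤ 4ℓ^(2k) − y²`.  (Reason: else `y = ℓ^k` and the numerator is `3ℓ^(2k)`, forcing `ℓ ∣ 3`.) -/
theorem not_top_dvd_four {ℓ : ℕ} (hℓ : ℓ.Prime) (hℓ3 : ℓ ≠ 3) {k y : ℕ} (hy : 0 < y)
    (hlt : y < 2 * ℓ ^ k) : ¬ ℓ ^ (2 * k + 1) ∣ 4 * ℓ ^ (2 * k) - y ^ 2 := by
  intro h
  have hyl : y = ℓ ^ k := eq_pow_of_top_dvd_four hℓ hy hlt h
  subst hyl
  rw [four_sub_pin, pow_succ] at h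
  have h3 : ℓ ∣ 3 := Nat.dvd_of_mul_dvd_mul_left (pow_pos hℓ.pos _) h
  exact hℓ3 ((Nat.prime_dvd_prime_iff_eq hℓ Nat.prime_three).mp h3)

/-- THE PIN AT `ℓ = 3`: `3^(2k+1) ∣ 4·3^(2k) − y²` with `0 < y < 2·3^k` iff `y = 3^k`, and then the
numerator equals `3^(2k+1)` (odd valuation `2k+1` — the exceptional term of Lemma V(c)). -/
theorem eq_pow_of_top_dvd_four_three {k y : ℕ} (hy : 0 < y) (hlt : y < 2 * 3 ^ k)
    (h : 3 ^ (2 * k + 1) ∣ 4 * 3 ^ (2 * k) - y ^ 2) : y = 3 ^ k :=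
  eq_pow_of_top_dvd_four Nat.prime_three hy hlt h

/-- At the `ℓ = 3` pin the numerator `4·3^(2k) − (3^k)²` equals `3^(2k+1)`. -/
theorem four_pin_value (k : ℕ) : 4 * 3 ^ (2 * k) - (3 ^ k) ^ 2 = 3 ^ (2 * k + 1) := by
  rw [four_sub_pin, pow_succ]

/-! ## Lemma V: parity of the valuations -/

/-- LEMMA V(a): for an odd prime `ℓ` and odd `x < 3ℓ^k`, `v_ℓ(9ℓ^(2k) − x²)` is EVEN. -/
theorem even_factorization_nine {ℓ : ℕ} (hℓ : ℓ.Prime) (hℓ2 : ℓ ≠ 2) {k x : ℕ} (hx : Odd x)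
    (hlt : x < 3 * ℓ ^ k) : Even ((9 * ℓ ^ (2 * k) - x ^ 2).factorization ℓ) := by
  have hxlt2 : x ^ 2 < 9 * ℓ ^ (2 * k) := by
    rw [← sq_three_mul_pow]; exact Nat.pow_lt_pow_left hlt two_ne_zero
  have hN0 : 9 * ℓ ^ (2 * k) - x ^ 2 ≠ 0 := by omega
  have hxD : 1 * (9 * ℓ ^ (2 * k) - x ^ 2) + x ^ 2 = 9 * ℓ ^ (2 * k) := by omega
  rcases factorization_even_or_ge hℓ (Nat.Prime.not_dvd_one hℓ) (dvd_mul_left _ _) hN0 hxD with hev | hge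
  · exact hev
  · rcases Nat.eq_or_lt_of_le hge with heq | hgt
    · exact ⟨k, by omega⟩
    · exact absurd ((hℓ.pow_dvd_iff_le_factorization hN0).mpr hgt) (not_top_dvd_nine hℓ hℓ2 hx hlt)

/-- LEMMA V(c), `ℓ ≠ 3`: for a prime `ℓ ≠ 3` and `0 < y < 2ℓ^k`, `v_ℓ(4ℓ^(2k) − y²)` is EVEN. -/
theorem even_factorization_four {ℓ : ℕ} (hℓ : ℓ.Prime) (hℓ3 : ℓ ≠ 3) {k y : ℕ} (hy : 0 < y)
    (hlt : y < 2 * ℓ ^ k) : Even ((4 * ℓ ^ (2 * k) - y ^ 2).factorization ℓ) := by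
  have hylt2 : y ^ 2 < 4 * ℓ ^ (2 * k) := by
    rw [← sq_two_mul_pow]; exact Nat.pow_lt_pow_left hlt two_ne_zero
  have hN0 : 4 * ℓ ^ (2 * k) - y ^ 2 ≠ 0 := by omega
  have hxD : 1 * (4 * ℓ ^ (2 * k) - y ^ 2) + y ^ 2 = 4 * ℓ ^ (2 * k) := by omega
  rcases factorization_even_or_ge hℓ (Nat.Prime.not_dvd_one hℓ) (dvd_mul_left _ _) hN0 hxD with hev | hge
  · exact hev
  · rcases Nat.eq_or_lt_of_le hge with heq | hgt
    · exact ⟨k, by omega⟩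
    · exact absurd ((hℓ.pow_dvd_iff_le_factorization hN0).mpr hgt) (not_top_dvd_four hℓ hℓ3 hy hlt)

/-- LEMMA V(c), `ℓ = 3`: for `0 < y < 2·3^k` with `y ≠ 3^k`, `v₃(4·3^(2k) − y²)` is EVEN
(and at `y = 3^k` it is `2k+1`, `four_pin_value`). -/
theorem even_factorization_four_three {k y : ℕ} (hy : 0 < y) (hlt : y < 2 * 3 ^ k)
    (hne : y ≠ 3 ^ k) : Even ((4 * 3 ^ (2 * k) - y ^ 2).factorization 3) := by
  have hylt2 : y ^ 2 < 4 * 3 ^ (2 * k) := by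
    rw [← sq_two_mul_pow]; exact Nat.pow_lt_pow_left hlt two_ne_zero
  have hN0 : 4 * 3 ^ (2 * k) - y ^ 2 ≠ 0 := by omega
  have hxD : 1 * (4 * 3 ^ (2 * k) - y ^ 2) + y ^ 2 = 4 * 3 ^ (2 * k) := by omega
  rcases factorization_even_or_ge Nat.prime_three (Nat.Prime.not_dvd_one Nat.prime_three)
      (dvd_mul_left _ _) hN0 hxD with hev | hge
  · exact hev
  · rcases Nat.eq_or_lt_of_le hge with heq | hgt
    · exact ⟨k, by omega⟩
    · exact absurd (eq_pow_of_top_dvd_four_three hy hlt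
        ((Nat.prime_three.pow_dvd_iff_le_factorization hN0).mpr hgt)) hne

/-- The valuation at the `ℓ = 3` pin is the odd number `2k+1`. -/
theorem factorization_four_pin (k : ℕ) : (4 * 3 ^ (2 * k) - (3 ^ k) ^ 2).factorization 3 = 2 * k + 1 := by
  rw [four_pin_value, Nat.Prime.factorization_pow Nat.prime_three, Finsupp.single_eq_same]

end Summit.HodgeConjecture.HodgeConjecture.HodgeLocus.Census.LVFamilyParity
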